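import Summits.BirchSwinnertonDyer.Rank1Residual.Additive.PadicClosureCyclotomicGalois
import Mathlib.NumberTheory.Padics.RingHoms
import Mathlib.Data.Nat.Choose.Dvd
import Mathlib.Algebra.Ring.GeomSum
import HarnessLib

/-!
# Integers of the layers `ℚ_p(ζ_{p^m}) ⊂ ℚ̄_p`: `𝒪 = ℤ_p[ζ − 1]` with coefficients read off by
# orthogonality, the Frobenius congruence `yᵖ ∈ 𝒪_{m−1} + p𝒪_m`, and the decomposition
# `𝒪_m ⊆ ∑_{p ∤ i} ℤ·ζⁱ + 𝒪_{m−1} + pᵃ𝒪_m` (cell `b2b-bsdres`, CLASS-CLOSURE lane, class O10 — x1b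
# GEN 33, class lead; file 32 of the local series: the cyclotomic arithmetic behind [K] Prop. 8.11)

HONEST FRAMING (cell `b2b-bsdres`, run/shared/lean/b2b/bsd-rank1-residual/, verbatim in every
file): the goal of the cell is to DELETE the COMBINATION-SHAPED residual classes of the
Birch–Swinnerton-Dyer formula for ALL analytic-rank `≤ 1` elliptic curves over `ℚ` — "full BSD
formula for every rank `≤ 1` curve in class `C`" assembled STRICTLY from published theorems — so
that the rank-`≤ 1` remainder becomes exactly the CONSTRUCTION-SHAPED classes, which are TYPED
(missing-input `Prop`s), NOT attempted. This is not "finishing BSD". CLASS-CLOSURE lane: prove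
what is provable now; shrink each hard class to its core with data; no claim beyond stated classes;
research routes on CONSTRUCTION-SHAPED X12 / O10; census / instrument output = EVIDENCE / conjecture
items, NEVER a Literature fact; `RESIDUAL-MAP.md` marks change only by signed lines. THIS FILE:
TOOL THEOREMS ONLY — no definition, no named Literature fact, no Summits-side fact `def … : Prop`,
no `sorry`, axioms standard; nothing is booked; no label / mark / count / sub-cell moves; O10 stays
OPEN / CONSTRUCTION-SHAPED; nothing about `BSD(W, p)` of any pair is claimed.

## Content (`Ω = PadicAlgCl p`, `ζ m = zeta p m`, `layer p m = ℚ_p(ζ m)`, `𝒪 = {‖·‖ ≤ 1}`)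

* §1 `norm_le_one_of_norm_lt_p` (the values of `ℚ_p` are `p^ℤ`); ultrametric congruence algebra in
  `Ω`: freshman's dream `‖(∑uᵢ)ᵖ − ∑uᵢᵖ‖ ≤ ‖p‖`, `‖aʲ − bʲ‖ ≤ ‖a − b‖` on `𝒪`.
* §2 **`exists_intPoly_aeval_eq`**: every `x ∈ layer m` with `‖x‖ ≤ 1` is `r(ζ m − 1)` for a
  polynomial `r ∈ ℤ_p[X]` (coefficients of norm `≤ 1`) of degree `< φ(p^m)` — `𝒪_m = ℤ_p[ζ − 1]`
  (orthogonality of the `π`-power basis, file 19, and `‖π‖^{−j} < p` for `j < φ(p^m)`).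
* §3 **`exists_frob_mem_layer_pred`**: for `y ∈ 𝒪 ∩ layer m` (`m ≥ 1`) there is
  `s ∈ 𝒪 ∩ layer (m−1)` with `‖yᵖ − s‖ ≤ ‖p‖` (`(∑cⱼπʲ)ᵖ ≡ ∑cⱼᵖ(ζᵖ − 1)ʲ`).
* §4 **`exists_decomp_layer`**: for `y ∈ 𝒪 ∩ layer m` and `a : ℕ` there are integers `N i` with
  `y = ∑_{i<φ, p∤i} Nᵢ ζⁱ + μ + pᵃ y'`, `μ ∈ 𝒪 ∩ layer (m−1)`, `y' ∈ 𝒪 ∩ layer m` (`PadicInt.appr`).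

References: [Kobayashi2003] §8.4 (Prop. 8.11, proof); [SerreLocalFields1979] Ch. IV §4;
[NeukirchANT1999] II (7.13).
-/

noncomputable section

open scoped Classical
open Polynomial Finset

namespace Summit.BirchSwinnertonDyer.Rank1Residual.Additive

namespace PadicCyclotomicTower

variable (p : ℕ) [hp : Fact p.Prime]

/-! ## §1 Norm arithmetic -/

/-- The values of `ℚ_p` are integral powers of `p`: `‖c‖ < p ⇒ ‖c‖ ≤ 1`. [folklore] -/
theorem norm_le_one_of_norm_lt_p {c : ℚ_[p]} (hc : ‖c‖ < p) : ‖c‖ ≤ 1 := by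
  by_cases h0 : c = 0
  · rw [h0, norm_zero]; exact zero_le_one
  rw [Padic.norm_eq_zpow_neg_valuation h0] at hc ⊢
  have hp1 : (1 : ℝ) < p := by exact_mod_cast hp.out.one_lt
  have h : -c.valuation < 1 := by
    by_contra hcon
    push Not at hcon
    have := zpow_le_zpow_right₀ hp1.le hcon
    rw [zpow_one] at this
    exact absurd (lt_of_le_of_lt this hc) (lt_irrefl _)
  calc (p : ℝ) ^ (-c.valuation) ≤ (p : ℝ) ^ (0 : ℤ) := zpow_le_zpow_right₀ hp1.le (by omega)
    _ = 1 := zpow_zero _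

/-- **Freshman's dream modulo `p`, two terms**: `‖(a+b)ᵖ − aᵖ − bᵖ‖ ≤ ‖p‖` for `‖a‖, ‖b‖ ≤ 1`.
[folklore] -/
theorem norm_add_pow_sub_le {a b : PadicAlgCl p} (ha : ‖a‖ ≤ 1) (hb : ‖b‖ ≤ 1) :
    ‖(a + b) ^ p - a ^ p - b ^ p‖ ≤ ‖(p : PadicAlgCl p)‖ := by
  have h := add_pow a b p
  -- split off `m = p` (`a^p`) and `m = 0` (`b^p`)
  rw [Finset.sum_range_succ, Nat.choose_self, Nat.cast_one, mul_one, Nat.sub_self, pow_zero, mul_one] at h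
  have hsplit := Finset.sum_erase_add (range p) (fun x => a ^ x * b ^ (p - x) * (p.choose x : PadicAlgCl p))
    (mem_range.mpr hp.out.pos)
  simp only [pow_zero, one_mul, Nat.sub_zero, Nat.choose_zero_right, Nat.cast_one, mul_one] at hsplit
  have e : (a + b) ^ p - a ^ p - b ^ p =
      ∑ m ∈ (range p).erase 0, a ^ m * b ^ (p - m) * (p.choose m : PadicAlgCl p) := by
    rw [h, ← hsplit]; ring
  rw [e]
  refine IsUltrametricDist.norm_sum_le_of_forall_le_of_nonneg (norm_nonneg _) fun m hm => ?_
  rw [Finset.mem_erase, Finset.mem_range] at hm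
  obtain ⟨k, hk⟩ := hp.out.dvd_choose_self hm.1 hm.2
  rw [hk, Nat.cast_mul, norm_mul, norm_mul, norm_mul, norm_pow, norm_pow]
  have hk1 : ‖(k : PadicAlgCl p)‖ ≤ 1 := by
    rw [← map_natCast (algebraMap ℚ_[p] (PadicAlgCl p)) k, PadicAlgCl.norm_extends]
    simpa using Padic.norm_int_le_one (p := p) (k : ℤ)
  calc ‖a‖ ^ m * ‖b‖ ^ (p - m) * (‖(p : PadicAlgCl p)‖ * ‖(k : PadicAlgCl p)‖)
      ≤ 1 * 1 * (‖(p : PadicAlgCl p)‖ * 1) := by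
        gcongr
        · exact pow_le_one₀ (norm_nonneg _) ha
        · exact pow_le_one₀ (norm_nonneg _) hb
    _ = ‖(p : PadicAlgCl p)‖ := by ring

/-- **Freshman's dream for finite sums**: `‖(∑ᵢuᵢ)ᵖ − ∑ᵢuᵢᵖ‖ ≤ ‖p‖` when all `‖uᵢ‖ ≤ 1`. [folklore] -/
theorem norm_sum_pow_sub_sum_pow_le {ι : Type*} (s : Finset ι) (u : ι → PadicAlgCl p) (hu : ∀ i ∈ s, ‖u i‖ ≤ 1) :
    ‖(∑ i ∈ s, u i) ^ p - ∑ i ∈ s, u i ^ p‖ ≤ ‖(p : PadicAlgCl p)‖ := by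
  induction s using Finset.induction_on with
  | empty => simp [zero_pow hp.out.ne_zero]
  | @insert i s hi ih =>
    have hui : ‖u i‖ ≤ 1 := hu i (Finset.mem_insert_self i s)
    have hus : ∀ j ∈ s, ‖u j‖ ≤ 1 := fun j hj => hu j (Finset.mem_insert_of_mem hj)
    have hS : ‖∑ j ∈ s, u j‖ ≤ 1 := IsUltrametricDist.norm_sum_le_of_forall_le_of_nonneg zero_le_one hus
    rw [Finset.sum_insert hi, Finset.sum_insert hi]
    have e : (u i + ∑ j ∈ s, u j) ^ p - (u i ^ p + ∑ j ∈ s, u j ^ p) =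
        ((u i + ∑ j ∈ s, u j) ^ p - u i ^ p - (∑ j ∈ s, u j) ^ p) + ((∑ j ∈ s, u j) ^ p - ∑ j ∈ s, u j ^ p) := by
      ring
    rw [e]
    exact (IsUltrametricDist.norm_add_le_max _ _).trans (max_le (norm_add_pow_sub_le p hui hS) (ih hus))

/-- `‖aʲ − bʲ‖ ≤ ‖a − b‖` for `‖a‖, ‖b‖ ≤ 1`. [folklore] -/
theorem norm_pow_sub_pow_le {a b : PadicAlgCl p} (ha : ‖a‖ ≤ 1) (hb : ‖b‖ ≤ 1) (j : ℕ) :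
    ‖a ^ j - b ^ j‖ ≤ ‖a - b‖ := by
  rw [← (Commute.all a b).geom_sum₂_mul j, norm_mul]
  refine mul_le_of_le_one_left (norm_nonneg _) ?_
  refine IsUltrametricDist.norm_sum_le_of_forall_le_of_nonneg zero_le_one fun i _ => ?_
  rw [norm_mul, norm_pow, norm_pow]
  calc ‖a‖ ^ i * ‖b‖ ^ (j - 1 - i) ≤ 1 * 1 :=
        mul_le_mul (pow_le_one₀ (norm_nonneg _) ha) (pow_le_one₀ (norm_nonneg _) hb) (by positivity) zero_le_one
    _ = 1 := one_mul 1

/-! ## §2 `𝒪_m = ℤ_p[ζ − 1]` -/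

/-- **Integral elements of the layer are integral polynomials in `π = ζ m − 1`**: for `x ∈ layer m`
with `‖x‖ ≤ 1` (`m ≥ 1`) there is `r ∈ ℚ_p[X]` of degree `< φ(p^m)` with all coefficients of norm
`≤ 1` and `r(ζ m − 1) = x`. [cite: SerreLocalFields1979, Ch. IV §4] -/
theorem exists_intPoly_aeval_eq {m : ℕ} (hm : 1 ≤ m) {x : PadicAlgCl p} (hx : x ∈ layer p m) (hx1 : ‖x‖ ≤ 1) :
    ∃ r : ℚ_[p][X], r.natDegree < (p ^ m).totient ∧ (∀ j, ‖r.coeff j‖ ≤ 1) ∧ aeval (zeta p m - 1) r = x := by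
  obtain ⟨r₀, hr₀, hx₀⟩ := exists_aeval_zeta_eq p hx
  set r : ℚ_[p][X] := r₀.comp (X + C 1) with hrdef
  have hdeg : r.natDegree = r₀.natDegree := by
    rw [hrdef, natDegree_comp, natDegree_X_add_C, mul_one]
  have haev : aeval (zeta p m - 1) r = x := by
    rw [hrdef, aeval_comp, map_add, aeval_X, aeval_C, map_one, sub_add_cancel, hx₀]
  refine ⟨r, by rw [hdeg]; exact hr₀, fun j => ?_, haev⟩
  -- orthogonality: `‖r_j‖ ‖π‖^j ≤ ‖x‖ ≤ 1`, and `‖π‖^j ≥ ‖π‖^{φ-1} > ‖π‖^φ = ‖p‖`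
  by_cases hj : r.natDegree < j
  · rw [coeff_eq_zero_of_natDegree_lt hj, norm_zero]; exact zero_le_one
  push Not at hj
  have hje : j < (p ^ m).totient := lt_of_le_of_lt hj (by rw [hdeg]; exact hr₀)
  have horth := norm_coeff_mul_le_norm_aeval p hm r (by rw [hdeg]; exact hr₀) j
  rw [haev] at horth
  have hπ0 := norm_zeta_sub_one_pos p hm
  have hπ1 := norm_zeta_sub_one_lt_one p hm
  have hπj : 0 < ‖zeta p m - 1‖ ^ j := pow_pos hπ0 j
  have h1 : ‖r.coeff j‖ ≤ (‖zeta p m - 1‖ ^ j)⁻¹ := by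
    rw [inv_eq_one_div, le_div_iff₀ hπj]
    exact horth.trans hx1
  -- `‖π‖^j > ‖π‖^φ = ‖p‖ = p⁻¹`
  have hnp : ‖(p : PadicAlgCl p)‖ = (p : ℝ)⁻¹ := by
    rw [← map_natCast (algebraMap ℚ_[p] (PadicAlgCl p)) p]
    exact (PadicAlgCl.norm_extends (p := p) (p : ℚ_[p])).trans Padic.norm_p
  have h2 : (p : ℝ)⁻¹ < ‖zeta p m - 1‖ ^ j := by
    rw [← hnp, ← norm_zeta_sub_one_pow p hm]
    exact pow_lt_pow_right_of_lt_one₀ hπ0 hπ1 hje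
  refine norm_le_one_of_norm_lt_p p (h1.trans_lt ?_)
  have hp0 : (0 : ℝ) < p := by exact_mod_cast hp.out.pos
  calc (‖zeta p m - 1‖ ^ j)⁻¹ < ((p : ℝ)⁻¹)⁻¹ := inv_strictAnti₀ (inv_pos.mpr hp0) h2
    _ = p := inv_inv _

/-! ## §3 The Frobenius congruence `yᵖ ∈ 𝒪_{m−1} + p𝒪_m` -/

/-- **Frobenius congruence in the cyclotomic tower**: for `y ∈ layer m`, `‖y‖ ≤ 1`, `m ≥ 1`, there is
`s ∈ layer (m − 1)` with `‖s‖ ≤ 1` and `‖yᵖ − s‖ ≤ ‖p‖` (`y = ∑cⱼπʲ`, `yᵖ ≡ ∑cⱼᵖ(ζᵖ − 1)ʲ`,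
`ζᵖ = ζ_{m−1}`). [cite: Kobayashi2003, Prop. 8.11] -/
theorem exists_frob_mem_layer_pred (hp2 : p ≠ 2) {m : ℕ} (hm : 1 ≤ m) {y : PadicAlgCl p} (hy : y ∈ layer p m)
    (hy1 : ‖y‖ ≤ 1) : ∃ s ∈ layer p (m - 1), ‖s‖ ≤ 1 ∧ ‖y ^ p - s‖ ≤ ‖(p : PadicAlgCl p)‖ := by
  obtain ⟨r, hr, hrc, hry⟩ := exists_intPoly_aeval_eq p hm hy hy1
  obtain ⟨m', rfl⟩ := Nat.exists_eq_add_of_le' hm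
  rw [Nat.add_sub_cancel]
  set π : PadicAlgCl p := zeta p (m' + 1) - 1 with hπ
  set π' : PadicAlgCl p := zeta p m' - 1 with hπ'
  set e := (p ^ (m' + 1)).totient with he
  -- `y = ∑_{j<e} c_j π^j`
  have hysum : y = ∑ j ∈ range e, algebraMap ℚ_[p] (PadicAlgCl p) (r.coeff j) * π ^ j := by
    rw [← hry, aeval_eq_sum_range' hr]
    simp only [Algebra.smul_def]
  set s : PadicAlgCl p := ∑ j ∈ range e, algebraMap ℚ_[p] (PadicAlgCl p) (r.coeff j) ^ p * π' ^ j with hs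
  have hc1 : ∀ j, ‖algebraMap ℚ_[p] (PadicAlgCl p) (r.coeff j)‖ ≤ 1 := fun j => by
    rw [PadicAlgCl.norm_extends]; exact hrc j
  have hπ1 : ‖π‖ ≤ 1 := (norm_zeta_sub_one_lt_one p hm).le
  have hπ'1 : ‖π'‖ ≤ 1 := norm_zeta_sub_one_le_one p m'
  refine ⟨s, ?_, ?_, ?_⟩
  · -- `s ∈ layer m'`
    refine Subalgebra.sum_mem _ fun j _ => ?_
    refine Subalgebra.mul_mem _ (Subalgebra.pow_mem _ (IntermediateField.algebraMap_mem _ _) _)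
      (Subalgebra.pow_mem _ ?_ _)
    exact IntermediateField.sub_mem _ (zeta_mem_layer p m') (IntermediateField.one_mem _)
  · refine IsUltrametricDist.norm_sum_le_of_forall_le_of_nonneg zero_le_one fun j _ => ?_
    rw [norm_mul, norm_pow, norm_pow]
    calc ‖algebraMap ℚ_[p] (PadicAlgCl p) (r.coeff j)‖ ^ p * ‖π'‖ ^ j ≤ 1 * 1 :=
          mul_le_mul (pow_le_one₀ (norm_nonneg _) (hc1 j)) (pow_le_one₀ (norm_nonneg _) hπ'1) (by positivity)
            zero_le_one
      _ = 1 := one_mul 1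
  · -- `‖y^p − s‖ ≤ ‖p‖`: freshman's dream, then `π^{pj} ≡ π'^j`
    have hu : ∀ j ∈ range e, ‖algebraMap ℚ_[p] (PadicAlgCl p) (r.coeff j) * π ^ j‖ ≤ 1 := fun j _ => by
      rw [norm_mul, norm_pow]
      calc _ ≤ 1 * (1 : ℝ) := mul_le_mul (hc1 j) (pow_le_one₀ (norm_nonneg _) hπ1) (by positivity) zero_le_one
        _ = 1 := one_mul 1
    have h1 := norm_sum_pow_sub_sum_pow_le p (range e) _ hu
    rw [← hysum] at h1
    -- termwise: `(c π^j)^p = c^p (π^p)^j` and `‖(π^p)^j − π'^j‖ ≤ ‖π^p − π'‖ ≤ ‖p‖`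
    have hππ' : ‖π ^ p - π'‖ ≤ ‖(p : PadicAlgCl p)‖ := by
      -- `(ζ − 1)^p ≡ ζ^p + (−1)^p = ζ' − 1`
      have h := norm_add_pow_sub_le p (a := zeta p (m' + 1)) (b := -1) (by rw [norm_zeta]) (by rw [norm_neg, norm_one])
      have hodd : ((-1 : PadicAlgCl p)) ^ p = -1 := (hp.out.odd_of_ne_two hp2).neg_one_pow
      have e : π ^ p - π' = (zeta p (m' + 1) + -1) ^ p - zeta p (m' + 1) ^ p - (-1) ^ p := by
        rw [hπ, hπ', hodd, zeta_succ_pow, sub_eq_add_neg (zeta p (m' + 1)) 1]; ring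
      rw [e]; exact h
    have h2 : ‖∑ j ∈ range e, (algebraMap ℚ_[p] (PadicAlgCl p) (r.coeff j) * π ^ j) ^ p - s‖ ≤ ‖(p : PadicAlgCl p)‖ := by
      rw [hs, ← Finset.sum_sub_distrib]
      refine IsUltrametricDist.norm_sum_le_of_forall_le_of_nonneg (norm_nonneg _) fun j _ => ?_
      rw [mul_pow, ← pow_mul, mul_comm j p, pow_mul, ← mul_sub, norm_mul, norm_pow]
      calc ‖algebraMap ℚ_[p] (PadicAlgCl p) (r.coeff j)‖ ^ p * ‖(π ^ p) ^ j - π' ^ j‖ ≤ 1 * ‖(p : PadicAlgCl p)‖ := by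
            refine mul_le_mul (pow_le_one₀ (norm_nonneg _) (hc1 j)) ?_ (norm_nonneg _) zero_le_one
            exact (norm_pow_sub_pow_le p (by rw [norm_pow]; exact pow_le_one₀ (norm_nonneg _) hπ1) hπ'1 j).trans hππ'
        _ = ‖(p : PadicAlgCl p)‖ := one_mul _
    have e : y ^ p - s = (y ^ p - ∑ j ∈ range e, (algebraMap ℚ_[p] (PadicAlgCl p) (r.coeff j) * π ^ j) ^ p) +
        (∑ j ∈ range e, (algebraMap ℚ_[p] (PadicAlgCl p) (r.coeff j) * π ^ j) ^ p - s) := by ring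
    rw [e]
    exact (IsUltrametricDist.norm_add_le_max _ _).trans (max_le h1 h2)

/-! ## §4 `𝒪_m ⊆ ℤ[Γ·ζ] + layer (m−1) + pᵃ𝒪_m` -/

/-- Powers of `ζ m` lie in the additive subgroup generated by the `Γ`-conjugates of `ζ m` together with
`layer (m−1)`: `ζⁱ = σᵢ(ζ)` for `p ∤ i`, and `ζⁱ = ζ_{m−1}^{i/p} ∈ layer (m−1)` for `p ∣ i`.
[cite: Kobayashi2003, Prop. 8.11] -/
theorem zeta_pow_mem_closure_sup {m : ℕ} (hm : 1 ≤ m) (i : ℕ) :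
    zeta p m ^ i ∈ AddSubgroup.closure (Set.range fun g : Field.absoluteGaloisGroup ℚ_[p] => g • zeta p m) ⊔
      (layer p (m - 1)).toSubalgebra.toSubring.toAddSubgroup := by
  by_cases hi : p ∣ i
  · obtain ⟨j, rfl⟩ := hi
    refine AddSubgroup.mem_sup_right ?_
    obtain ⟨m', rfl⟩ := Nat.exists_eq_add_of_le' hm
    rw [Nat.add_sub_cancel, pow_mul, zeta_succ_pow]
    exact Subalgebra.pow_mem _ (zeta_mem_layer p m') j
  · refine AddSubgroup.mem_sup_left (AddSubgroup.subset_closure ?_)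
    have hcop : i.Coprime p := (Nat.coprime_comm.mp ((Nat.Prime.coprime_iff_not_dvd hp.out).mpr hi))
    obtain ⟨σ, hσ⟩ := exists_algEquiv_apply_zeta_eq_pow p hm hcop
    refine ⟨(Field.absoluteGaloisGroup.toAlgEquiv ℚ_[p]).symm σ, ?_⟩
    change ((Field.absoluteGaloisGroup.toAlgEquiv ℚ_[p]).symm σ) • zeta p m = zeta p m ^ i
    rw [Field.absoluteGaloisGroup.smul_def, MulEquiv.apply_symm_apply, hσ]

/-- Integral polynomial values `r(ζ − 1)` with INTEGER coefficients lie in `ℤ[Γ·ζ] + layer (m−1)`. [folklore] -/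
theorem aeval_intCast_mem_closure_sup {m : ℕ} (hm : 1 ≤ m) (N : ℕ → ℤ) (e : ℕ) :
    (∑ j ∈ range e, (N j : PadicAlgCl p) * (zeta p m - 1) ^ j) ∈
      AddSubgroup.closure (Set.range fun g : Field.absoluteGaloisGroup ℚ_[p] => g • zeta p m) ⊔
        (layer p (m - 1)).toSubalgebra.toSubring.toAddSubgroup := by
  set T := AddSubgroup.closure (Set.range fun g : Field.absoluteGaloisGroup ℚ_[p] => g • zeta p m) ⊔
    (layer p (m - 1)).toSubalgebra.toSubring.toAddSubgroup with hT
  refine AddSubgroup.sum_mem _ fun j _ => ?_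
  -- `(ζ − 1)^j = ∑ᵢ C(j,i) ζⁱ (−1)^{j−i}` is a `ℤ`-combination of powers of `ζ`
  rw [sub_eq_add_neg, add_pow]
  rw [Finset.mul_sum]
  refine AddSubgroup.sum_mem _ fun i _ => ?_
  have hz : zeta p m ^ i ∈ T := zeta_pow_mem_closure_sup p hm i
  have e1 : (N j : PadicAlgCl p) * (zeta p m ^ i * (-1) ^ (j - i) * (j.choose i : PadicAlgCl p)) =
      ((N j * (-1) ^ (j - i) * (j.choose i : ℤ) : ℤ) : PadicAlgCl p) * zeta p m ^ i := by
    push_cast; ring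
  rw [e1, ← zsmul_eq_mul]
  exact AddSubgroup.zsmul_mem _ hz _

/-- **`𝒪_m ⊆ ℤ[Γ·ζ_m] + layer (m−1) + pᵃ𝒪_m`**: for `y ∈ layer m` with `‖y‖ ≤ 1` (`m ≥ 1`) and any
`a`, there is `y' ∈ layer m`, `‖y'‖ ≤ 1`, with `y − pᵃ y'` in the additive subgroup generated by the
`Γ`-conjugates of `ζ m` and `layer (m−1)` (`y = ∑ cⱼ πʲ`, `cⱼ = Nⱼ + pᵃcⱼ'` by `PadicInt.appr`).
[cite: Kobayashi2003, Prop. 8.11] -/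
theorem exists_sub_pow_mul_mem_closure_sup {m : ℕ} (hm : 1 ≤ m) {y : PadicAlgCl p} (hy : y ∈ layer p m)
    (hy1 : ‖y‖ ≤ 1) (a : ℕ) :
    ∃ y' ∈ layer p m, ‖y'‖ ≤ 1 ∧
      y - (p : PadicAlgCl p) ^ a * y' ∈
        AddSubgroup.closure (Set.range fun g : Field.absoluteGaloisGroup ℚ_[p] => g • zeta p m) ⊔
          (layer p (m - 1)).toSubalgebra.toSubring.toAddSubgroup := by
  obtain ⟨r, hr, hrc, hry⟩ := exists_intPoly_aeval_eq p hm hy hy1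
  set e := (p ^ m).totient with he
  set π : PadicAlgCl p := zeta p m - 1 with hπ
  -- integral coefficients as elements of `ℤ_p`, approximated by naturals mod `p^a`
  set c : ℕ → ℤ_[p] := fun j => ⟨r.coeff j, hrc j⟩ with hc
  set N : ℕ → ℕ := fun j => (c j).appr a with hN
  have happr : ∀ j, ∃ d : ℤ_[p], c j - (N j : ℤ_[p]) = (p : ℤ_[p]) ^ a * d := fun j => by
    have h := PadicInt.appr_spec a (c j)
    rw [Ideal.mem_span_singleton] at h
    exact h
  choose d hd using happr
  set y' : PadicAlgCl p := ∑ j ∈ range e, algebraMap ℚ_[p] (PadicAlgCl p) ((d j : ℤ_[p]) : ℚ_[p]) * π ^ j with hy'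
  have hπ1 : ‖π‖ ≤ 1 := norm_zeta_sub_one_le_one p m
  refine ⟨y', ?_, ?_, ?_⟩
  · refine Subalgebra.sum_mem _ fun j _ => Subalgebra.mul_mem _ (IntermediateField.algebraMap_mem _ _)
      (Subalgebra.pow_mem _ (IntermediateField.sub_mem _ (zeta_mem_layer p m) (IntermediateField.one_mem _)) _)
  · refine IsUltrametricDist.norm_sum_le_of_forall_le_of_nonneg zero_le_one fun j _ => ?_
    rw [norm_mul, norm_pow, PadicAlgCl.norm_extends]
    calc ‖((d j : ℤ_[p]) : ℚ_[p])‖ * ‖π‖ ^ j ≤ 1 * 1 :=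
          mul_le_mul (PadicInt.norm_le_one _) (pow_le_one₀ (norm_nonneg _) hπ1) (by positivity) zero_le_one
      _ = 1 := one_mul 1
  · -- `y − p^a y' = ∑ N_j π^j`
    have hysum : y = ∑ j ∈ range e, algebraMap ℚ_[p] (PadicAlgCl p) (r.coeff j) * π ^ j := by
      rw [← hry, aeval_eq_sum_range' hr]
      simp only [Algebra.smul_def]
    have hdiff : y - (p : PadicAlgCl p) ^ a * y' = ∑ j ∈ range e, ((N j : ℤ) : PadicAlgCl p) * π ^ j := by
      rw [hysum, hy', Finset.mul_sum, ← Finset.sum_sub_distrib]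
      refine Finset.sum_congr rfl fun j _ => ?_
      have hcj : r.coeff j = ((c j : ℤ_[p]) : ℚ_[p]) := rfl
      have hdj : ((c j : ℤ_[p]) : ℚ_[p]) = (N j : ℚ_[p]) + (p : ℚ_[p]) ^ a * ((d j : ℤ_[p]) : ℚ_[p]) := by
        have := congrArg (fun z : ℤ_[p] => (z : ℚ_[p])) (hd j)
        push_cast at this
        linear_combination this
      rw [hcj, hdj, map_add, map_mul, map_pow, map_natCast, map_natCast]
      push_cast
      ring
    rw [hdiff]
    exact aeval_intCast_mem_closure_sup p hm (fun j => (N j : ℤ)) e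

end PadicCyclotomicTower

end Summit.BirchSwinnertonDyer.Rank1Residual.Additive

end
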